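import Summits.BirchSwinnertonDyer.BirchSwinnertonDyer.Theorems.PrintCf2RamifiedOffTYZEvenSquareFormLevelThree
import Summits.BirchSwinnertonDyer.BirchSwinnertonDyer.Theorems.PrintCf2RamifiedOffTYZEvenOmegaDefs
import HarnessLib

/-!
# Crux `PrintCf2.RamifiedOffTYZOfFacts` (stmt-BirchSwinnertonDyer-20509), line `offtyz-v7`, LEAD cycle 14 (cruxlead-20509 g13):
# THE EVEN SQUARE FORM = `evenSquareFormMatrix` AT THE BITS — the bridge from the Galois side to the pure `𝔽₂`-matrix side

THEOREMS ONLY (no `def`, no named fact, no `sorry`), `--supports stmt-BirchSwinnertonDyer-20509`.  Re-indexing `Fin S.card ↔ S` of the sub-tuple sums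
and the identification of the level-2/3 chain coefficients with `EvenOmegaDefs.chainCoeff`, turning `galPt_mul_self_P_eq_add_evenSquareForm`
(`…EvenSquareFormLevelThree`) into ★ `galPt_mul_self_P_eq_add_evenSquareFormMatrix`:
`g·g·P(n) = P(n) + val(evenSquareFormMatrix p (x_im g) (x_2 g) (x g))·τ(1)` for EVERY automorphism `g` — so the conjectured EVEN Ω-IDENTITY
`evenSquareFormMatrix p = evenOmegaFormMatrix p` (crux workfile `Lines/offtyz_v7_EvenOmega.lean`, a pure Legendre-symbol identity, verified on
10135 tuples) is now EXACTLY what separates the even sector of C⁺ (and Smith's `S(6)` at 100 %) from a kernel theorem.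
BSD is not proved by any of this; no class is closed by this file.

References: [cite: TianYuanZhang2017, Thm. 1.1, §3.1 (p0011 L1–L13, L53–L73), Prop. 3.2 (1)(2), Thm. 3.6 (1)(2), proof of Lemma 3.21 (p0020 L27–L63)];
[cite: HeathBrown1994SelmerCongruentII, Appendix (Monsky), typescript p. 39 L10 – p. 41 L36]; [cite: Smith2016CongruentDensity, Thm. 2.2 rows 1–3].
-/

noncomputable section

open scoped Classical NumberField

open WeierstrassCurve WeierstrassCurve.Affine Finset Matrix Literature.NumberTheory.EllipticCurves
  Literature.NumberTheory.EllipticCurves.TianYuanZhang2017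
  Literature.NumberTheory.EllipticCurves.TianYuanZhang2017.W2
  Literature.NumberTheory.EllipticCurves.HeathBrown1994
  Literature.NumberTheory.EllipticCurves.HeathBrown1994.Families
  Literature.NumberTheory.EllipticCurves.Smith2016
  Literature.NumberTheory.EllipticCurves.MonskySelmerParity
  Literature.NumberTheory.QuadraticFields.RingClass
  Literature.NumberTheory.QuadraticFields
  Literature.LinearAlgebra.Matrix
  Summit.BirchSwinnertonDyer.Rank1Residual.P2.GenusPeriodTransferLayer
  Summit.BirchSwinnertonDyer.Rank1Residual.P2.ThetaDescent
  Summit.BirchSwinnertonDyer.PrintCf2.QForm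
  Summit.BirchSwinnertonDyer.PrintCf2.EvenOmegaDefs

set_option autoImplicit false

namespace Summit.BirchSwinnertonDyer.PrintCf2.MoverAssembly

variable {k : ℕ} (p : Fin k → ℕ) (hp : ∀ i, (p i).Prime) (hodd : ∀ i, Odd (p i)) (hinj : Function.Injective p)

/-! ## §1 Re-indexing the sub-tuple sums -/

/-- `Σ_t f(q_t) = Σ_{i∈S} f(pᵢ)` for `q = blockPrimes p S`. [folklore] -/
theorem sum_blockPrimes_eq_sum {M : Type*} [AddCommMonoid M] (S : Finset (Fin k)) (f : ℕ → M) :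
    ∑ t : Fin S.card, f (blockPrimes p S t) = ∑ i ∈ S, f (p i) := by
  rw [← sum_coe_sort S]
  exact (S.orderIsoOfFin rfl).toEquiv.sum_comp (fun x : {x // x ∈ S} => f (p (x : Fin k)))

/-- `Σ_t κ^S_t·f(q_t) = Σ_{i∈S} blockKappaSix p S i·f(pᵢ)` (the kernel sum of `N_S` read back on `S`). [folklore] -/
theorem sum_kerSum_six_blockPrimes_eq_sum (S : Finset (Fin k)) (f : ℕ → ZMod 2) :
    (∑ t : Fin S.card, kerSum (blockSixMatrix p S) (Sum.inl t) * f (blockPrimes p S t)) =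
      ∑ i ∈ S, blockKappaSix p S i * f (p i) := by
  set e := (S.orderIsoOfFin rfl).toEquiv with he
  rw [← sum_coe_sort S]
  have hk : ∀ x : {x // x ∈ S}, blockKappaSix p S (x : Fin k) = kerSum (blockSixMatrix p S) (Sum.inl (e.symm x)) := by
    intro x
    rw [blockKappaSix, dif_pos x.2]
    rfl
  rw [Finset.sum_congr rfl (fun (x : {x // x ∈ S}) _ => by rw [hk x])]
  rw [← e.sum_comp (fun x : {x // x ∈ S} => kerSum (blockSixMatrix p S) (Sum.inl (e.symm x)) * f (p (x : Fin k)))]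
  refine Finset.sum_congr rfl fun t _ => ?_
  rw [Equiv.symm_apply_apply]
  rfl

/-! ## §2 The chain coefficient -/

/-- **`chainCoeff p T = c₂(T) + c₃(T)`** for `d_T ≡ 5 (mod 8)` inside `∏pᵢ ≡ 3 (mod 4)`: the `S = univ` slice of `chainCoeff` is the level-2
coefficient (`det M_odd(∅) = 1`, `univ ∖ W = Wᶜ`), the rest is the level-3 coefficient; the extra residue conditions of `chainCoeff`
(`d_{S∖W} ≡ 1 (4)`, `d_{W∖T} ≡ 3 (8)`) are automatic. [cite: TianYuanZhang2017, §3.1 (p0011 L67–L73)] -/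
theorem chainCoeff_eq_levelTwo_add_levelThree (h3 : (∏ i, p i) % 4 = 3) (T : Finset (Fin k)) (h5 : (∏ i ∈ T, p i) % 8 = 5) :
    chainCoeff p T =
      (∑ W : Finset (Fin k), if T ⊆ W ∧ T ≠ W ∧ (∏ i ∈ W, p i) % 8 = 7 then
          (monskyMatrixEven (blockPrimes p Wᶜ)).det * (monskyMatrixOdd (blockPrimes p (W \ T))).det else 0) +
        ∑ S : Finset (Fin k), ∑ W : Finset (Fin k),
          if T ⊆ W ∧ T ≠ W ∧ W ⊆ S ∧ (∏ i ∈ Sᶜ, p i) % 8 = 1 ∧ S ≠ univ ∧ (∏ i ∈ W, p i) % 8 = 7 then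
            coblockWeight p S * (monskyMatrixEven (blockPrimes p (S \ W))).det * (monskyMatrixOdd (blockPrimes p (W \ T))).det
          else 0 := by
  unfold chainCoeff
  rw [Fintype.sum_eq_add_sum_compl (univ : Finset (Fin k)), Fintype.sum_eq_add_sum_compl (univ : Finset (Fin k))
    (fun S => ∑ W : Finset (Fin k), if T ⊆ W ∧ T ≠ W ∧ W ⊆ S ∧ (∏ i ∈ Sᶜ, p i) % 8 = 1 ∧ S ≠ univ ∧ (∏ i ∈ W, p i) % 8 = 7 then
      coblockWeight p S * (monskyMatrixEven (blockPrimes p (S \ W))).det * (monskyMatrixOdd (blockPrimes p (W \ T))).det else 0)]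
  have huniv0 : (∑ W : Finset (Fin k), if T ⊆ W ∧ T ≠ W ∧ W ⊆ univ ∧ (∏ i ∈ (univ : Finset (Fin k))ᶜ, p i) % 8 = 1 ∧ (univ : Finset (Fin k)) ≠ univ ∧
      (∏ i ∈ W, p i) % 8 = 7 then
      coblockWeight p univ * (monskyMatrixEven (blockPrimes p (univ \ W))).det * (monskyMatrixOdd (blockPrimes p (W \ T))).det else 0) = 0 :=
    Finset.sum_eq_zero fun W _ => if_neg (fun h => h.2.2.2.2.1 rfl)
  rw [huniv0, zero_add]
  congr 1
  · -- the `S = univ` slice is the level-2 coefficient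
    refine Finset.sum_congr rfl fun W _ => ?_
    rw [← Finset.compl_eq_univ_sdiff W]
    by_cases hc : T ⊆ W ∧ T ≠ W ∧ (∏ i ∈ W, p i) % 8 = 7
    · obtain ⟨hTW, hne, h7⟩ := hc
      have hWc : (∏ i ∈ Wᶜ, p i) % 4 = 1 := by
        have hsplit : (∏ j ∈ W, p j) * (∏ j ∈ Wᶜ, p j) = ∏ i, p i := Finset.prod_mul_prod_compl W p
        have hmod := Nat.mul_mod (∏ j ∈ W, p j) (∏ j ∈ Wᶜ, p j) 4
        rw [hsplit, h3, show (∏ j ∈ W, p j) % 4 = 3 by omega] at hmod; omega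
      have hWT : (∏ i ∈ W \ T, p i) % 8 = 3 := sdiff_mod_eight_three p hTW h7 h5
      have h1 : (∏ i ∈ (univ : Finset (Fin k))ᶜ, p i) % 8 = 1 := by simp
      rw [if_pos ⟨hTW, hne, subset_univ W, h1, h7, hWc, hWT⟩, if_pos ⟨hTW, hne, h7⟩]
      show (monskyMatrixOdd (blockPrimes p (univ : Finset (Fin k))ᶜ)).det * ((monskyMatrixEven (blockPrimes p Wᶜ)).det) *
          (monskyMatrixOdd (blockPrimes p (W \ T))).det =
        (monskyMatrixEven (blockPrimes p Wᶜ)).det * (monskyMatrixOdd (blockPrimes p (W \ T))).det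
      rw [show (monskyMatrixOdd (blockPrimes p (univ : Finset (Fin k))ᶜ)).det = 1 from coblockWeight_univ p, one_mul]
    · rw [if_neg (fun h => hc ⟨h.1, h.2.1, h.2.2.2.2.1⟩), if_neg hc]
  · refine Finset.sum_congr rfl fun S hS => Finset.sum_congr rfl fun W _ => ?_
    have hSu : S ≠ univ := by rw [Finset.mem_compl, Finset.mem_singleton] at hS; exact hS
    by_cases hc : T ⊆ W ∧ T ≠ W ∧ W ⊆ S ∧ (∏ i ∈ Sᶜ, p i) % 8 = 1 ∧ S ≠ univ ∧ (∏ i ∈ W, p i) % 8 = 7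
    · obtain ⟨hTW, hne, hWS, hS1, -, h7⟩ := hc
      have hS4 := blockProd_mod_four_of_compl_one p h3 S hS1
      have hSW : (∏ i ∈ S \ W, p i) % 4 = 1 := sdiff_mod_four_one p hWS hS4 (by omega)
      have hWT : (∏ i ∈ W \ T, p i) % 8 = 3 := sdiff_mod_eight_three p hTW h7 h5
      rw [if_pos ⟨hTW, hne, hWS, hS1, h7, hSW, hWT⟩, if_pos ⟨hTW, hne, hWS, hS1, hSu, h7⟩]
      rfl
    · rw [if_neg (fun h => hc ⟨h.1, h.2.1, h.2.2.1, h.2.2.2.1, hSu, h.2.2.2.2.1⟩), if_neg hc]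

variable {n : ℕ} (D : GenusPointData n)

/-- The bit sum over the sub-tuple is the bit sum over `S`. [folklore] -/
theorem sum_bits_blockPrimes (S : Finset (Fin k)) (g : D.H ≃ₐ[ℚ] D.H) :
    (∑ t : Fin S.card, (if g (D.im * D.sqrtNeg (blockPrimes p S t)) = D.im * D.sqrtNeg (blockPrimes p S t) then (0 : ZMod 2) else 1)) =
      ∑ i ∈ S, (if g (D.im * D.sqrtNeg (p i)) = D.im * D.sqrtNeg (p i) then (0 : ZMod 2) else 1) :=
  sum_blockPrimes_eq_sum p S (fun q => if g (D.im * D.sqrtNeg q) = D.im * D.sqrtNeg q then (0 : ZMod 2) else 1)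

/-- The `κ^S`-weighted bit sum over the sub-tuple is `Σ_{i∈S} blockKappaSix p S i · xᵢ`. [folklore] -/
theorem sum_kerSum_bits_blockPrimes (S : Finset (Fin k)) (g : D.H ≃ₐ[ℚ] D.H) :
    (∑ t : Fin S.card,
      kerSum (Matrix.fromBlocks (legendreMatrix (blockPrimes p S) + legendreDiagonal (blockPrimes p S) (-2))
          (Matrix.of fun j (_ : Unit) => addLegendreSym 2 (blockPrimes p S j))
          (0 : Matrix Unit (Fin S.card) (ZMod 2)) (0 : Matrix Unit Unit (ZMod 2))) (Sum.inl t) *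
        (if g (D.im * D.sqrtNeg (blockPrimes p S t)) = D.im * D.sqrtNeg (blockPrimes p S t) then (0 : ZMod 2) else 1)) =
      ∑ i ∈ S, blockKappaSix p S i * (if g (D.im * D.sqrtNeg (p i)) = D.im * D.sqrtNeg (p i) then (0 : ZMod 2) else 1) :=
  sum_kerSum_six_blockPrimes_eq_sum p S (fun q => if g (D.im * D.sqrtNeg q) = D.im * D.sqrtNeg q then (0 : ZMod 2) else 1)

/-! ## §3 The square motion of every `g` is `evenSquareFormMatrix` at its bits -/

include hp hodd hinj in
/-- ★ **`g·g·P(n) = P(n) + val(evenSquareFormMatrix p (x_im g) (x_2 g) (x g))·τ(1)` for EVERY automorphism `g` of `ℍ′_n`** (`n = 2p₁⋯p_k`,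
`∏pᵢ ≡ 3 (mod 4)`, the displayed recursion, the block clauses of `CMPointRingClassFrobeniusValuePrinted`, TYZ Thm 1.1), with the bits
`x_im g = [g(i) ≠ i]`, `x_2 g = [g(i√−2) ≠ i√−2]`, `x g j = [g(i√−p_j) ≠ i√−p_j]`.  Hence: `g·g` moves `P(n)` iff `evenSquareFormMatrix p (bits g) = 1`;
the EVEN Ω-IDENTITY `evenSquareFormMatrix p = evenOmegaFormMatrix p` (conjecture, crux workfile `Lines/offtyz_v7_EvenOmega.lean`) would make this
the adjugate form of Monsky's even matrix.
[cite: TianYuanZhang2017, Thm. 1.1, §3.1 (p0011 L1–L13, L53–L73), Prop. 3.2 (1)(2), Thm. 3.6 (1)(2), proof of Lemma 3.21 (p0020 L27–L63)]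
[cite: HeathBrown1994SelmerCongruentII, Appendix (Monsky), typescript p. 39 L10 – p. 41 L36] [cite: Cox2013, §5.C Lemma 5.19, §7.D, §9.A] -/
theorem galPt_mul_self_P_eq_add_evenSquareFormMatrix (hn : n = 2 * ∏ i, p i) (h3 : (∏ i, p i) % 4 = 3) (hrec : D.recursion)
    (hLs : D.scriptLSpec) (h11 : thm11_parity_of_scriptL)
    {zf : ℕ → APoint D.H} {Φf : ℕ → Finset (D.H ≃ₐ[ℚ] D.H)} {ΓHf ΓH'f : ℕ → Subgroup (D.H ≃ₐ[ℚ] D.H)}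
    {σf θf : ℕ → (D.H ≃ₐ[ℚ] D.H)} {cf : D.H ≃ₐ[ℚ] D.H} (hc : D.ConjSpec cf)
    {ρ₂ : (d : ℕ) → (D.galK d →* RingClassGroup (GenusField d) 2)}
    {ρ₄ : (d : ℕ) → (D.galK d →* RingClassGroup (GenusField d) 4)}
    (hb : ∀ d ∈ n.divisors,
      ((d % 8 = 5 ∨ d % 8 = 6) → D.CMBlockSpec d (zf d) (Φf d) (ΓHf d) (ΓH'f d) (σf d) cf) ∧
      (d % 8 = 6 → D.ThetaBlockSpec d (zf d) (ΓHf d) (ΓH'f d) (σf d) (θf d)) ∧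
      (d % 8 = 7 → D.SevenBlockSpec d) ∧
      (d % 8 = 5 → D.RingClassTwoBlockSpec d (ΓHf d) (ΓH'f d) (ρ₂ d)) ∧
      (d % 8 = 6 → D.RingClassFourBlockSpec d (ΓHf d) (ΓH'f d) (ρ₄ d)) ∧
      (d % 8 = 5 → D.FrobeniusTwoBlockSpec d (ΓH'f d)) ∧
      (d % 8 = 6 → D.FrobeniusFourBlockSpec d (ΓH'f d)) ∧
      (d % 8 = 6 → D.FrobeniusFourValueBlockSpec d (ΓH'f d) (ρ₄ d)))
    (g : D.H ≃ₐ[ℚ] D.H) :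
    D.galPt (g * g) (D.P n) = D.P n +
      (ZMod.val (evenSquareFormMatrix p (if g D.im = D.im then (0 : ZMod 2) else 1)
        (if g (D.im * D.sqrtNeg 2) = D.im * D.sqrtNeg 2 then (0 : ZMod 2) else 1)
        (fun i => if g (D.im * D.sqrtNeg (p i)) = D.im * D.sqrtNeg (p i) then (0 : ZMod 2) else 1))) • tauOne := by
  rw [galPt_mul_self_P_eq_add_evenSquareForm p hp hodd hinj D hn h3 hrec hLs h11 hc hb g]
  refine congrArg (fun z : ZMod 2 => D.P n + z.val • (tauOne : APoint D.H)) ?_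
  unfold evenSquareFormMatrix
  congr 1
  · refine Finset.sum_congr rfl fun S _ => ?_
    by_cases hS1 : (∏ i ∈ Sᶜ, p i) % 8 = 1
    · rw [if_pos hS1, if_pos hS1, sum_bits_blockPrimes p D S g, sum_kerSum_bits_blockPrimes p D S g, ← mul_assoc]
      rfl
    · rw [if_neg hS1, if_neg hS1]
  · refine Finset.sum_congr rfl fun T _ => ?_
    by_cases h5 : (∏ i ∈ T, p i) % 8 = 5
    · rw [if_pos h5, if_pos h5, sum_bits_blockPrimes p D T g, ← chainCoeff_eq_levelTwo_add_levelThree p h3 T h5, ← mul_assoc]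
    · rw [if_neg h5, if_neg h5]

include hp hodd hinj in
/-- **Corollary (silence test)**: if `evenSquareFormMatrix p` vanishes at the bits of `g`, then `g·g` fixes `P(n)`.
[cite: TianYuanZhang2017, §3.1, Thm. 3.6 (1)(2), proof of Lemma 3.21] -/
theorem galPt_mul_self_P_eq_of_evenSquareFormMatrix_eq_zero (hn : n = 2 * ∏ i, p i) (h3 : (∏ i, p i) % 4 = 3) (hrec : D.recursion)
    (hLs : D.scriptLSpec) (h11 : thm11_parity_of_scriptL)
    {zf : ℕ → APoint D.H} {Φf : ℕ → Finset (D.H ≃ₐ[ℚ] D.H)} {ΓHf ΓH'f : ℕ → Subgroup (D.H ≃ₐ[ℚ] D.H)}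
    {σf θf : ℕ → (D.H ≃ₐ[ℚ] D.H)} {cf : D.H ≃ₐ[ℚ] D.H} (hc : D.ConjSpec cf)
    {ρ₂ : (d : ℕ) → (D.galK d →* RingClassGroup (GenusField d) 2)}
    {ρ₄ : (d : ℕ) → (D.galK d →* RingClassGroup (GenusField d) 4)}
    (hb : ∀ d ∈ n.divisors,
      ((d % 8 = 5 ∨ d % 8 = 6) → D.CMBlockSpec d (zf d) (Φf d) (ΓHf d) (ΓH'f d) (σf d) cf) ∧
      (d % 8 = 6 → D.ThetaBlockSpec d (zf d) (ΓHf d) (ΓH'f d) (σf d) (θf d)) ∧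
      (d % 8 = 7 → D.SevenBlockSpec d) ∧
      (d % 8 = 5 → D.RingClassTwoBlockSpec d (ΓHf d) (ΓH'f d) (ρ₂ d)) ∧
      (d % 8 = 6 → D.RingClassFourBlockSpec d (ΓHf d) (ΓH'f d) (ρ₄ d)) ∧
      (d % 8 = 5 → D.FrobeniusTwoBlockSpec d (ΓH'f d)) ∧
      (d % 8 = 6 → D.FrobeniusFourBlockSpec d (ΓH'f d)) ∧
      (d % 8 = 6 → D.FrobeniusFourValueBlockSpec d (ΓH'f d) (ρ₄ d)))
    (g : D.H ≃ₐ[ℚ] D.H)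
    (h0 : evenSquareFormMatrix p (if g D.im = D.im then (0 : ZMod 2) else 1)
        (if g (D.im * D.sqrtNeg 2) = D.im * D.sqrtNeg 2 then (0 : ZMod 2) else 1)
        (fun i => if g (D.im * D.sqrtNeg (p i)) = D.im * D.sqrtNeg (p i) then (0 : ZMod 2) else 1) = 0) :
    D.galPt (g * g) (D.P n) = D.P n := by
  rw [galPt_mul_self_P_eq_add_evenSquareFormMatrix p hp hodd hinj D hn h3 hrec hLs h11 hc hb g, h0, ZMod.val_zero, zero_smul, add_zero]

include hp hodd hinj in
/-- **Corollary (mover test)**: if `evenSquareFormMatrix p` is `1` at the bits of `g`, then `g·g` moves `P(n)`.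
[cite: TianYuanZhang2017, §3.1, Thm. 3.6 (1)(2), proof of Lemma 3.21] -/
theorem galPt_mul_self_P_ne_of_evenSquareFormMatrix_eq_one (hn : n = 2 * ∏ i, p i) (h3 : (∏ i, p i) % 4 = 3) (hrec : D.recursion)
    (hLs : D.scriptLSpec) (h11 : thm11_parity_of_scriptL)
    {zf : ℕ → APoint D.H} {Φf : ℕ → Finset (D.H ≃ₐ[ℚ] D.H)} {ΓHf ΓH'f : ℕ → Subgroup (D.H ≃ₐ[ℚ] D.H)}
    {σf θf : ℕ → (D.H ≃ₐ[ℚ] D.H)} {cf : D.H ≃ₐ[ℚ] D.H} (hc : D.ConjSpec cf)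
    {ρ₂ : (d : ℕ) → (D.galK d →* RingClassGroup (GenusField d) 2)}
    {ρ₄ : (d : ℕ) → (D.galK d →* RingClassGroup (GenusField d) 4)}
    (hb : ∀ d ∈ n.divisors,
      ((d % 8 = 5 ∨ d % 8 = 6) → D.CMBlockSpec d (zf d) (Φf d) (ΓHf d) (ΓH'f d) (σf d) cf) ∧
      (d % 8 = 6 → D.ThetaBlockSpec d (zf d) (ΓHf d) (ΓH'f d) (σf d) (θf d)) ∧
      (d % 8 = 7 → D.SevenBlockSpec d) ∧
      (d % 8 = 5 → D.RingClassTwoBlockSpec d (ΓHf d) (ΓH'f d) (ρ₂ d)) ∧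
      (d % 8 = 6 → D.RingClassFourBlockSpec d (ΓHf d) (ΓH'f d) (ρ₄ d)) ∧
      (d % 8 = 5 → D.FrobeniusTwoBlockSpec d (ΓH'f d)) ∧
      (d % 8 = 6 → D.FrobeniusFourBlockSpec d (ΓH'f d)) ∧
      (d % 8 = 6 → D.FrobeniusFourValueBlockSpec d (ΓH'f d) (ρ₄ d)))
    (g : D.H ≃ₐ[ℚ] D.H)
    (h1 : evenSquareFormMatrix p (if g D.im = D.im then (0 : ZMod 2) else 1)
        (if g (D.im * D.sqrtNeg 2) = D.im * D.sqrtNeg 2 then (0 : ZMod 2) else 1)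
        (fun i => if g (D.im * D.sqrtNeg (p i)) = D.im * D.sqrtNeg (p i) then (0 : ZMod 2) else 1) = 1) :
    D.galPt (g * g) (D.P n) ≠ D.P n := by
  rw [galPt_mul_self_P_eq_add_evenSquareFormMatrix p hp hodd hinj D hn h3 hrec hLs h11 hc hb g, h1]
  have hv : ZMod.val (1 : ZMod 2) = 1 := rfl
  rw [hv, one_smul]
  intro h
  exact tauOne_ne_zero (add_eq_left.mp h)

end Summit.BirchSwinnertonDyer.PrintCf2.MoverAssembly

end
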